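/-
Copyright (c) 2026 the pub-hodgecm-mathlib formalisation cell (harness21).  Prover seat hodgecm-mathlib-LH4-p14 (g6), req620 Track A «(D-RAM) FOUR-FRAME» squad, helper lane
on h413 = stmt-HodgeConjecture-24833 (count-neutral).  STAGE-1b ARITHMETIC brick (V9) — ★ p859406 (V7) ∘ ★ p859425 (V8): the row-(1) token hypothesis `hA` for a
HALF-DIFFERENCE OF TWO SHIFTED AMPLITUDES (the derived T₊ token of heir LEAD T19-32 ∕ D-1b §4), letters explicit.  2026-09-04.
-/
import Summits.HodgeConjecture.HodgeConjecture.Theorems.F0P3cDyRamAmplShiftAffine      -- ★ p859406 (V7) `affine_token_of_amplShift`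
import Summits.HodgeConjecture.HodgeConjecture.Theorems.F0P3cDyRamAffineTokenLinear     -- ★ p859425 (V8) `affine_token_linear`
import HarnessLib

/-!
# Crux `H413`, line LH4 «(D-RAM) FOUR-FRAME» — (V9) `hA` FOR THE DERIVED T₊ TOKEN `½(ampl(q, k − ks₁, B − bs₁) − ampl(q, k − ks₂, B − bs₂))`, LETTERS EXPLICIT

Cell `hodgecm-mathlib` (D-0151), FLOOR 0, crux item H413 = `stmt-HodgeConjecture-24833`, route `HCCMUnconditional`; squad F0∕P3c∕LH4.  THEOREMS ONLY (one theorem; no `def`, no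
instance, no notation, no `sorry`, default heartbeats); ★ imports only; lane `--supports stmt-HodgeConjecture-24833 --as helper`; COUNT-NEUTRAL (composition of ★ (V7) and ★ (V8);
`hAmp` — the token's letters — and `hΩ` — the covered-cell sign fact — are HYPOTHESES).

WHY.  On the derived road (heir LEAD T19-32; dealer LH4-plan (g13) D-1b §4) the κ-law token of `f_{T+}` is `A_T = ½(A₁ − A₂)` with `Aᵢ q d t k B = ampl q (k − ksᵢ) (B − bsᵢ)`
the two level tokens at square level `m_c` (F0P3-p01 (g35) TEMPLATE: `(ks₁, bs₁) = (s, s)`, `(ks₂, bs₂) = (s + 1, s − 1)`, `s = d − 1 + ℓ₀`).  ★ p859406 §2 gives `hA` for each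
`Aᵢ` at explicit letters; ★ p859425 makes `hA` linear.  This file composes them: **`affine_token_of_amplHalfDiff … (ks₁ bs₁ ks₂ bs₂) (hAmp) (hΩ)`** : the `hA` of ★ p859212 for
`A` at `cA := ½·C·2·(q_w^{−ks₁} − q_w^{−ks₂})`, `cB := ½·C·4·((q_w^{−ks₁} − q_w^{S−ks₁+bs₁}) − (q_w^{−ks₂} − q_w^{S−ks₂+bs₂}))∕(q_w − 1)` (written as the `½`-combination of ★ (V7)'s
letters), floor `max N₁ N₂`.  So the (H-T+) assembly ★ p859596's FIRST letter is discharged for the derived token the minute its exponent schedules are lettered — no fit.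
HONEST LABEL.  Count-neutral; pays no registered stub, touches no `Lines/` module, asserts no law; `HC_CM` is proved only modulo the 7 printed citations (2 remaining named inputs:
hLiu418 = `stmt-HodgeConjecture-24832`, h413 = `stmt-HodgeConjecture-24833`) until rung 0 closes.

## References
* [Rogawski1990] J. D. Rogawski, *Automorphic Representations of Unitary Groups in Three Variables*, Ann. of Math. Stud. 123 (1990): §4.9 Prop. 4.9.1 (b) p. 55, Lemma 4.9.3 (4.9.2) p. 56.
* [LabesseLanglands1979] J.-P. Labesse, R. P. Langlands, *L-indistinguishability for SL(2)*, Canad. J. Math. 31 (1979), §2 (2.2).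
-/

set_option autoImplicit false

noncomputable section

namespace Summit.HodgeConjecture.HodgeConjecture.Cruxes.H413.F0P3cDyRamAmplHalfDiffAffine

open NumberField IsDedekindDomain
open Literature.NumberTheory.Automorphic Literature.NumberTheory.Automorphic.UnitaryGroup Literature.NumberTheory.GaloisRepresentations
open Literature.NumberTheory.Automorphic.UnitaryThreeFourFrame
open Summit.HodgeConjecture.HodgeConjecture.Cruxes.H413.F0P3cDyRamFourFrameLawDefsR2
open Summit.HodgeConjecture.HodgeConjecture.Cruxes.H413.F0P3cDyRamAmplShiftAffine
open Summit.HodgeConjecture.HodgeConjecture.Cruxes.H413.F0P3cDyRamAffineTokenLinear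
open scoped Matrix MatrixGroups Classical ValuativeRel WithZero

/-- **(V9) `affine_token_of_amplHalfDiff`** — the `hA` of ★ p859212 for a token `A q d t_E k B = (ampl q (k − ks₁) (B − bs₁) − ampl q (k − ks₂) (B − bs₂)) ∕ 2`, at the
`½`-combination of ★ (V7)'s letters and the floor `max N₁ N₂`; ★ p859406 §2 ×2 + ★ p859425 (`c₁ = ½`, `c₂ = −½`).  The derived T₊ token of the TEMPLATE is the instance
`(ks₁, bs₁, ks₂, bs₂) = (s, s, s + 1, s − 1)`, `s = d − 1 + ℓ₀`. [cite: Rogawski1990, §4.9 Prop. 4.9.1 (b) p. 55, Lemma 4.9.3 (4.9.2) p. 56] [cite: LabesseLanglands1979, §2 (2.2)] -/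
theorem affine_token_of_amplHalfDiff (shift : ℕ → ℕ → ℤ) (Ω : OmegaSchedule) (N₀ : ℕ → ℕ) (A : ℕ → ℕ → ℕ → ℕ → ℤ → ℚ)
    (L : Type) [Field L] [NumberField L] [IsCMField L]
    {v : HeightOneSpectrum (𝓞 ↥(maximalRealSubfield L))} (w : UnitaryGroup.PlacesOver L v)
    (hw : IsCMField.complexConj L • w.1 = w.1) (ϖ : (w.1.adicCompletion L)) (d tE : ℕ)
    [Fintype (Valued.ResidueField (w.1.adicCompletion L))] (C : ℂ) (ks₁ bs₁ ks₂ bs₂ : ℕ)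
    (hAmp : ∀ (q k : ℕ) (B : ℤ), A q d tE k B = (ampl q (k - ks₁) (B - bs₁) - ampl q (k - ks₂) (B - bs₂)) / 2)
    (hΩ : ∀ (a b : (w.1.adicCompletion L)) (n₁ n₂ n₃ : ℕ),
      a * (galAdicCompletionMap (L := L) (IsCMField.complexConj L) hw) a = 1 → b * (galAdicCompletionMap (L := L) (IsCMField.complexConj L) hw) b = 1 →
      IsElementDatum (galAdicCompletionMap (L := L) (IsCMField.complexConj L) hw) ϖ (N₀ d) (a * a) (b * b) n₁ n₂ n₃ →
      Ω (w.1.adicCompletion L) (galAdicCompletionMap (L := L) (IsCMField.complexConj L) hw) ϖ d a b 2 = 1) :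
    ∀ (a b : (w.1.adicCompletion L)) (n₁ n₂ n₃ k : ℕ) (i : Fin 3) (B : ℤ),
        a * (galAdicCompletionMap (L := L) (IsCMField.complexConj L) hw) a = 1 → b * (galAdicCompletionMap (L := L) (IsCMField.complexConj L) hw) b = 1 →
        IsElementDatum (galAdicCompletionMap (L := L) (IsCMField.complexConj L) hw) ϖ (N₀ d) (a * a) (b * b) n₁ n₂ n₃ →
        2 * ((n₁ + n₂) / 2) = n₁ + n₂ → 2 * k + d = n₁ + n₂ + n₃ + 2 → 2 * B = ((![n₁, n₂, n₃] : Fin 3 → ℕ) i : ℤ) - d + 2 - 2 * shift d tE → i = 2 →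
        max (d + 2 * (ks₁ + bs₁) + 2 * (shift d tE).natAbs) (d + 2 * (ks₂ + bs₂) + 2 * (shift d tE).natAbs) ≤ n₃ → (n₃ + d) % 2 = 0 →
        C * ((Fintype.card (Valued.ResidueField (w.1.adicCompletion L)) : ℂ) ^ ((n₁ + n₂) / 2))⁻¹ * (((Ω (w.1.adicCompletion L) (galAdicCompletionMap (L := L) (IsCMField.complexConj L) hw) ϖ d a b i : ℤ) : ℂ) * ((A (Fintype.card (Valued.ResidueField (w.1.adicCompletion L))) d tE k B : ℚ) : ℂ)) =
          (((1/2 : ℚ) : ℂ) * (C * ((2 * (Fintype.card (Valued.ResidueField (w.1.adicCompletion L)) : ℚ) ^ (-(ks₁ : ℤ)) : ℚ) : ℂ)) + ((-1/2 : ℚ) : ℂ) * (C * ((2 * (Fintype.card (Valued.ResidueField (w.1.adicCompletion L)) : ℚ) ^ (-(ks₂ : ℤ)) : ℚ) : ℂ))) * (((2 * ((Fintype.card (Valued.ResidueField (w.1.adicCompletion L)) : ℚ) ^ (((n₃ - d) / 2 : ℕ) + 1) - 1) / ((Fintype.card (Valued.ResidueField (w.1.adicCompletion L)) : ℚ) -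 1) : ℚ)) : ℂ) + (((1/2 : ℚ) : ℂ) * (C * ((4 * ((Fintype.card (Valued.ResidueField (w.1.adicCompletion L)) : ℚ) ^ (-(ks₁ : ℤ)) - (Fintype.card (Valued.ResidueField (w.1.adicCompletion L)) : ℚ) ^ (shift d tE - ks₁ + bs₁)) / ((Fintype.card (Valued.ResidueField (w.1.adicCompletion L)) : ℚ) - 1) : ℚ) : ℂ)) + ((-1/2 : ℚ) : ℂ) * (C * ((4 * ((Fintype.card (Valued.ResidueField (w.1.adicCompletion L)) : ℚ) ^ (-(ks₂ : ℤ)) - (Fintype.card (Valued.ResidueField (w.1.adicCompletion L)) : ℚ) ^ (shift d tE - ks₂ + bs₂)) / ((Fintype.card (Valued.ResidueField (w.1.adicCompletion L)) : ℚ) - 1) : ℚ) : ℂ))) :=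
  affine_token_linear shift Ω N₀ A (fun q d' t k B => ampl q (k - ks₁) (B - bs₁)) (fun q d' t k B => ampl q (k - ks₂) (B - bs₂)) L w hw ϖ d tE C
    (C * ((2 * (Fintype.card (Valued.ResidueField (w.1.adicCompletion L)) : ℚ) ^ (-(ks₁ : ℤ)) : ℚ) : ℂ)) (C * ((4 * ((Fintype.card (Valued.ResidueField (w.1.adicCompletion L)) : ℚ) ^ (-(ks₁ : ℤ)) - (Fintype.card (Valued.ResidueField (w.1.adicCompletion L)) : ℚ) ^ (shift d tE - ks₁ + bs₁)) / ((Fintype.card (Valued.ResidueField (w.1.adicCompletion L)) : ℚ) - 1) : ℚ) : ℂ)) (C * ((2 * (Fintype.card (Valued.ResidueField (w.1.adicCompletion L)) : ℚ) ^ (-(ks₂ : ℤ)) : ℚ) : ℂ)) (C * ((4 * ((Fintype.card (Valued.ResidueField (w.1.adicCompletion L)) : ℚ) ^ (-(ks₂ : ℤ)) - (Fintype.card (Valued.ResidueField (w.1.adicCompletion L)) : ℚ) ^ (shift d tE - ks₂ + bs₂)) / ((Fintype.card (Valued.ResidueField (w.1.adicCompletion L)) : ℚ) - 1) : ℚ)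 : ℂ)) (d + 2 * (ks₁ + bs₁) + 2 * (shift d tE).natAbs) (d + 2 * (ks₂ + bs₂) + 2 * (shift d tE).natAbs) (1/2 : ℚ) (-1/2 : ℚ)
    (fun q k B => by rw [hAmp]; ring)
    (affine_token_of_amplShift shift Ω N₀ (fun q d' t k B => ampl q (k - ks₁) (B - bs₁)) L w hw ϖ d tE C ks₁ bs₁ (fun _ _ _ => rfl) hΩ)
    (affine_token_of_amplShift shift Ω N₀ (fun q d' t k B => ampl q (k - ks₂) (B - bs₂)) L w hw ϖ d tE C ks₂ bs₂ (fun _ _ _ => rfl) hΩ)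

end Summit.HodgeConjecture.HodgeConjecture.Cruxes.H413.F0P3cDyRamAmplHalfDiffAffine

end
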